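import Mathlib
import Summits.Ventures.PercRepro2.Harris
import Summits.Ventures.PercRepro2.RestrictClosure
import Summits.Ventures.PercRepro2.HCov
import Summits.Ventures.PercRepro2.SepZero

/-!
# The (SEP-2) class, I: the two blocks of a separating pair and the cleared product law
(blind cell PercRepro2, typer-1 g49; LEAD-CYCLES.md §4, S3-CLASSES §S3.8 and (G7))

Setting: `K = C_{G − {a₁, a₂}}(o)` is the component of the root `o` in `G − {a₁, a₂}`
(`SepPair.sepConfig`), `F₁ = touches K` the edges touching it, `F₂ = F₁ᶜ` the rest.  On
`Q = {a₁ ↮ a₂}` (`avoidAll ends a₂ {a₁}`) a connection `a_i ↔ v` lives inside the block of `v`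
(the exit lemmas of `RestrictClosure.lean`), so every event built from the marks is *determined*
by one block on `Q` (`DetOn`, closed under `∩`, `∪`, `ᶜ`): `{a_i ↔ o}` and — when `a₃ ∈ K` —
`T`, `T′`, `PD` by `F₁`; `{a_j ↔ b}` for `b ∉ K` and — when `a₃ ∉ K` — `T`, `T′`, `PD` by `F₂`.
Since `Q = Q₁ ∩ Q₂` splits along the blocks (`SepPair.not_conn_pair_iff`), independence of
disjoint edge sets gives the **cleared product law** for `S, T ⊆ Q` determined by `F₁` resp.
`F₂`: `P(S ∩ T) · P(Q) = P(S) · P(T)` (`prob_inter_mul_of_detOn`), and its two mass forms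
`P(W ∩ (X ∩ Y)) · P(Q) = P(Q ∩ X) · P(W ∩ Y)` (`mass_split`, `W` on the `b`-side) and
`= P(W ∩ X) · P(Q ∩ Y)` (`mass_split'`, `W` on the `o`-side).  `SepTwoGcZero.lean` collapses the
thirty masses of `Gc` with them.  Own work (mine-2's `SepPair` machinery, the typer's `SepZero`
events); standard axioms.
-/

namespace Summit.Ventures.PercRepro2

namespace SepTwoGcZero

open CovForm SepPair SepZero

/-! ## Events determined by one block of edges on `Q = {a₁ ↮ a₂}` -/

section DetOn

variable {V : Type*} {E : Type*}

/-- `S` is determined by the edges of `F` on `Q = {a₁ ↮ a₂}`: for `ω ∈ Q`, `ω ∈ S` iff the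
restriction of `ω` to `F` lies in `S`. -/
def DetOn (ends : E → Sym2 V) (a₁ a₂ : V) (F : Set E) [DecidablePred (· ∈ F)]
    (S : Set (Config E)) : Prop :=
  ∀ ω : Config E, ¬ Conn ends ω a₁ a₂ → (ω ∈ S ↔ restrictTo F ω ∈ S)

variable {ends : E → Sym2 V} {a₁ a₂ : V} {F : Set E} [DecidablePred (· ∈ F)]

/-- Intersections of determined events are determined. -/
lemma DetOn.inter {S T : Set (Config E)} (hS : DetOn ends a₁ a₂ F S) (hT : DetOn ends a₁ a₂ F T) :
    DetOn ends a₁ a₂ F (S ∩ T) := fun ω hω => by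
  rw [Set.mem_inter_iff, Set.mem_inter_iff, hS ω hω, hT ω hω]

/-- Unions of determined events are determined. -/
lemma DetOn.union {S T : Set (Config E)} (hS : DetOn ends a₁ a₂ F S) (hT : DetOn ends a₁ a₂ F T) :
    DetOn ends a₁ a₂ F (S ∪ T) := fun ω hω => by
  rw [Set.mem_union, Set.mem_union, hS ω hω, hT ω hω]

/-- Complements of determined events are determined. -/
lemma DetOn.compl {S : Set (Config E)} (hS : DetOn ends a₁ a₂ F S) :
    DetOn ends a₁ a₂ F Sᶜ := fun ω hω => by
  rw [Set.mem_compl_iff, Set.mem_compl_iff, hS ω hω]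

/-- The whole space is determined. -/
lemma detOn_univ : DetOn ends a₁ a₂ F (Set.univ : Set (Config E)) := fun _ _ => by simp

/-- `Q = {a₁ ↮ a₂}` itself (as `avoidAll ends a₂ {a₁}`) is determined by every block: on `Q`
both sides are true, a restriction having fewer open edges. -/
lemma detOn_Q : DetOn ends a₁ a₂ F (avoidAll ends a₂ {a₁}) := fun ω hω => by
  rw [mem_Q, mem_Q]
  exact ⟨fun _ h => hω (conn_of_conn_restrictTo h), fun _ => hω⟩

/-- `{a₁ ↮ a₂}` as the complement of `connEvent ends a₁ a₂` is determined by every block. -/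
lemma detOn_compl_conn₁₂ : DetOn ends a₁ a₂ F (connEvent ends a₁ a₂)ᶜ := fun ω hω => by
  simp only [Set.mem_compl_iff, mem_connEvent]
  exact ⟨fun _ h => hω (conn_of_conn_restrictTo h), fun _ => hω⟩

/-- `{a₂ ↮ a₁}` as the complement of `connEvent ends a₂ a₁` is determined by every block. -/
lemma detOn_compl_conn₂₁ : DetOn ends a₁ a₂ F (connEvent ends a₂ a₁)ᶜ := fun ω hω => by
  simp only [Set.mem_compl_iff, mem_connEvent]
  exact ⟨fun _ h => hω (conn_symm (conn_of_conn_restrictTo h)), fun _ h => hω (conn_symm h)⟩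

end DetOn

/-! ## The two blocks of a separating pair: which connections live where -/

section Blocks

variable {V : Type*} {E : Type*} {ends : E → Sym2 V} {o a₁ a₂ : V}

/-- The exit hypothesis for `F₁ = touches K` from any vertex `v ∈ K` (the root's form is
`SepPair.exit_touches`). -/
lemma exit_touches_of_mem (ho : o ∉ ({a₁, a₂} : Set V)) {v : V}
    (hv : v ∈ cluster ends (sepConfig ends {a₁, a₂}) o)
    [DecidablePred (· ∈ touches ends (cluster ends (sepConfig ends {a₁, a₂}) o))] (ω : Config E) :
    ∀ e x y, ω e = true → ends e = s(x, y) →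
      e ∉ touches ends (cluster ends (sepConfig ends {a₁, a₂}) o) →
      Conn ends (restrictTo (touches ends (cluster ends (sepConfig ends {a₁, a₂}) o)) ω) v x →
        x ∈ ({a₁, a₂} : Set V) := by
  intro e x y _ hends heF hx
  rcases mem_union_of_conn_restrictTo_touches ho (Or.inl hv) hx with hxK | hxA
  · exact absurd (mem_touches_of_ends hends (Or.inl hxK)) heF
  · exact hxA

section BlockOne

variable [DecidablePred (· ∈ touches ends (cluster ends (sepConfig ends {a₁, a₂}) o))]

/-- On `Q`, a connection `i ↔ v` with `i ∈ {a₁, a₂}` and `v ∈ K` lives inside `F₁`. -/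
lemma conn_iff_restrict_of_mem (ho : o ∉ ({a₁, a₂} : Set V)) {v : V}
    (hv : v ∈ cluster ends (sepConfig ends {a₁, a₂}) o) {i : V} (hi : i = a₁ ∨ i = a₂)
    {ω : Config E} (hω : ¬ Conn ends ω a₁ a₂) :
    Conn ends ω i v ↔
      Conn ends (restrictTo (touches ends (cluster ends (sepConfig ends {a₁, a₂}) o)) ω) i v :=
  ⟨fun h => conn_symm (conn_restrictTo_of_not_conn (exit_touches_of_mem ho hv ω) hω hi
      (conn_symm h)),
    fun h => conn_of_conn_restrictTo h⟩

/-- `{i ↔ v}`, `v ∈ K`, is determined by `F₁`. -/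
lemma detOn_connEvent_of_mem (ho : o ∉ ({a₁, a₂} : Set V)) {v : V}
    (hv : v ∈ cluster ends (sepConfig ends {a₁, a₂}) o) {i : V} (hi : i = a₁ ∨ i = a₂) :
    DetOn ends a₁ a₂ (touches ends (cluster ends (sepConfig ends {a₁, a₂}) o))
      (connEvent ends i v) := fun ω hω => by
  simp only [mem_connEvent]
  exact conn_iff_restrict_of_mem ho hv hi hω

/-- `{v ↔ i}`, `v ∈ K`, is determined by `F₁`. -/
lemma detOn_connEvent_of_mem' (ho : o ∉ ({a₁, a₂} : Set V)) {v : V}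
    (hv : v ∈ cluster ends (sepConfig ends {a₁, a₂}) o) {i : V} (hi : i = a₁ ∨ i = a₂) :
    DetOn ends a₁ a₂ (touches ends (cluster ends (sepConfig ends {a₁, a₂}) o))
      (connEvent ends v i) := by
  rw [connEvent_comm]
  exact detOn_connEvent_of_mem ho hv hi

/-- `T = {a₁ ↮ a₂, a₂ ↔ a₃}` is determined by the block of `a₃` (here `a₃ ∈ K`: `F₁`). -/
lemma detOn_T_of_mem (ho : o ∉ ({a₁, a₂} : Set V)) {a₃ : V}
    (h₃ : a₃ ∈ cluster ends (sepConfig ends {a₁, a₂}) o) :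
    DetOn ends a₁ a₂ (touches ends (cluster ends (sepConfig ends {a₁, a₂}) o))
      (TEvent ends a₁ a₂ a₃) :=
  detOn_compl_conn₂₁.inter (detOn_connEvent_of_mem ho h₃ (Or.inr rfl))

/-- `T′ = {a₁ ↮ a₂, a₁ ↔ a₃}` is determined by the block of `a₃` (here `a₃ ∈ K`: `F₁`). -/
lemma detOn_T'_of_mem (ho : o ∉ ({a₁, a₂} : Set V)) {a₃ : V}
    (h₃ : a₃ ∈ cluster ends (sepConfig ends {a₁, a₂}) o) :
    DetOn ends a₁ a₂ (touches ends (cluster ends (sepConfig ends {a₁, a₂}) o))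
      (TEvent ends a₂ a₁ a₃) :=
  detOn_compl_conn₁₂.inter (detOn_connEvent_of_mem ho h₃ (Or.inl rfl))

/-- `PD = {a₁ ↮ a₂, a₃ ∉ U}` is determined by the block of `a₃` (here `a₃ ∈ K`: `F₁`). -/
lemma detOn_PD_of_mem (ho : o ∉ ({a₁, a₂} : Set V)) {a₃ : V}
    (h₃ : a₃ ∈ cluster ends (sepConfig ends {a₁, a₂}) o) :
    DetOn ends a₁ a₂ (touches ends (cluster ends (sepConfig ends {a₁, a₂}) o))
      (PDEvent ends a₁ a₂ a₃) :=
  detOn_compl_conn₁₂.inter ((detOn_connEvent_of_mem' ho h₃ (Or.inl rfl)).union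
    (detOn_connEvent_of_mem' ho h₃ (Or.inr rfl))).compl

end BlockOne

section BlockTwo

variable [DecidablePred (· ∈ (touches ends (cluster ends (sepConfig ends {a₁, a₂}) o))ᶜ)]

/-- On `Q`, a connection `i ↔ v` with `i ∈ {a₁, a₂}` and `v ∉ K` lives inside `F₂ = F₁ᶜ`. -/
lemma conn_iff_restrict_of_not_mem (ho : o ∉ ({a₁, a₂} : Set V)) {v : V}
    (hv : v ∉ cluster ends (sepConfig ends {a₁, a₂}) o) {i : V} (hi : i = a₁ ∨ i = a₂)
    {ω : Config E} (hω : ¬ Conn ends ω a₁ a₂) :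
    Conn ends ω i v ↔
      Conn ends (restrictTo (touches ends (cluster ends (sepConfig ends {a₁, a₂}) o))ᶜ ω) i v :=
  ⟨fun h => conn_symm (conn_restrictTo_of_not_conn (exit_compl ho hv ω) hω hi (conn_symm h)),
    fun h => conn_of_conn_restrictTo h⟩

/-- `{i ↔ v}`, `v ∉ K`, is determined by `F₂`. -/
lemma detOn_connEvent_of_not_mem (ho : o ∉ ({a₁, a₂} : Set V)) {v : V}
    (hv : v ∉ cluster ends (sepConfig ends {a₁, a₂}) o) {i : V} (hi : i = a₁ ∨ i = a₂) :
    DetOn ends a₁ a₂ (touches ends (cluster ends (sepConfig ends {a₁, a₂}) o))ᶜ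
      (connEvent ends i v) := fun ω hω => by
  simp only [mem_connEvent]
  exact conn_iff_restrict_of_not_mem ho hv hi hω

/-- `{v ↔ i}`, `v ∉ K`, is determined by `F₂`. -/
lemma detOn_connEvent_of_not_mem' (ho : o ∉ ({a₁, a₂} : Set V)) {v : V}
    (hv : v ∉ cluster ends (sepConfig ends {a₁, a₂}) o) {i : V} (hi : i = a₁ ∨ i = a₂) :
    DetOn ends a₁ a₂ (touches ends (cluster ends (sepConfig ends {a₁, a₂}) o))ᶜ
      (connEvent ends v i) := by
  rw [connEvent_comm]
  exact detOn_connEvent_of_not_mem ho hv hi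

/-- `T` is determined by `F₂` when `a₃ ∉ K`. -/
lemma detOn_T_of_not_mem (ho : o ∉ ({a₁, a₂} : Set V)) {a₃ : V}
    (h₃ : a₃ ∉ cluster ends (sepConfig ends {a₁, a₂}) o) :
    DetOn ends a₁ a₂ (touches ends (cluster ends (sepConfig ends {a₁, a₂}) o))ᶜ
      (TEvent ends a₁ a₂ a₃) :=
  detOn_compl_conn₂₁.inter (detOn_connEvent_of_not_mem ho h₃ (Or.inr rfl))

/-- `T′` is determined by `F₂` when `a₃ ∉ K`. -/
lemma detOn_T'_of_not_mem (ho : o ∉ ({a₁, a₂} : Set V)) {a₃ : V}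
    (h₃ : a₃ ∉ cluster ends (sepConfig ends {a₁, a₂}) o) :
    DetOn ends a₁ a₂ (touches ends (cluster ends (sepConfig ends {a₁, a₂}) o))ᶜ
      (TEvent ends a₂ a₁ a₃) :=
  detOn_compl_conn₁₂.inter (detOn_connEvent_of_not_mem ho h₃ (Or.inl rfl))

/-- `PD` is determined by `F₂` when `a₃ ∉ K`. -/
lemma detOn_PD_of_not_mem (ho : o ∉ ({a₁, a₂} : Set V)) {a₃ : V}
    (h₃ : a₃ ∉ cluster ends (sepConfig ends {a₁, a₂}) o) :
    DetOn ends a₁ a₂ (touches ends (cluster ends (sepConfig ends {a₁, a₂}) o))ᶜ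
      (PDEvent ends a₁ a₂ a₃) :=
  detOn_compl_conn₁₂.inter ((detOn_connEvent_of_not_mem' ho h₃ (Or.inl rfl)).union
    (detOn_connEvent_of_not_mem' ho h₃ (Or.inr rfl))).compl

end BlockTwo

end Blocks

/-! ## The cleared product law across the pair -/

section Product

variable {V : Type*} {E : Type*} [Fintype E] [DecidableEq E] {R : Type*} [CommRing R]
  {ends : E → Sym2 V} {o a₁ a₂ : V}
  [DecidablePred (· ∈ touches ends (cluster ends (sepConfig ends {a₁, a₂}) o))]
  [DecidablePred (· ∈ (touches ends (cluster ends (sepConfig ends {a₁, a₂}) o))ᶜ)]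

omit [Fintype E] [DecidableEq E] in
/-- Events inside `Q` lie on `Q`. -/
lemma not_conn_of_mem_of_subset {S : Set (Config E)} (hS : S ⊆ avoidAll ends a₂ {a₁})
    {ω : Config E} (h : ω ∈ S) : ¬ Conn ends ω a₁ a₂ :=
  mem_Q.1 (hS h)

/-- **The cleared product law across the pair.**  For `S, T ⊆ Q` with `S` determined by `F₁`
and `T` by `F₂` on `Q`: `P(S ∩ T) · P(Q) = P(S) · P(T)`. -/
theorem prob_inter_mul_of_detOn (p : E → R) (ho : o ∉ ({a₁, a₂} : Set V))
    {S T : Set (Config E)} (hSQ : S ⊆ avoidAll ends a₂ {a₁}) (hTQ : T ⊆ avoidAll ends a₂ {a₁})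
    (hS : DetOn ends a₁ a₂ (touches ends (cluster ends (sepConfig ends {a₁, a₂}) o)) S)
    (hT : DetOn ends a₁ a₂ (touches ends (cluster ends (sepConfig ends {a₁, a₂}) o))ᶜ T) :
    prob p (S ∩ T) * prob p (avoidAll ends a₂ {a₁}) = prob p S * prob p T := by
  -- the split of `Q` along the two blocks
  have hDω : ∀ ω : Config E, ¬ Conn ends ω a₁ a₂ ↔
      ¬ Conn ends (restrictTo (touches ends (cluster ends (sepConfig ends {a₁, a₂}) o)) ω) a₁ a₂ ∧
      ¬ Conn ends (restrictTo (touches ends (cluster ends (sepConfig ends {a₁, a₂}) o))ᶜ ω)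
        a₁ a₂ :=
    fun ω => not_conn_pair_iff ho ω
  -- independence of the two blocks
  have ind : ∀ A B : Set (Config E),
      prob p (restrictTo (touches ends (cluster ends (sepConfig ends {a₁, a₂}) o)) ⁻¹' A ∩
          restrictTo (touches ends (cluster ends (sepConfig ends {a₁, a₂}) o))ᶜ ⁻¹' B) =
        prob p (restrictTo (touches ends (cluster ends (sepConfig ends {a₁, a₂}) o)) ⁻¹' A) *
          prob p (restrictTo (touches ends (cluster ends (sepConfig ends {a₁, a₂}) o))ᶜ ⁻¹' B) :=
    fun A B => prob_inter_eq_mul_of_dependsOn p disjoint_compl_right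
      (dependsOn_restrictTo _ A) (dependsOn_restrictTo _ B)
  -- the four events as products
  have e1 : S ∩ T =
      restrictTo (touches ends (cluster ends (sepConfig ends {a₁, a₂}) o)) ⁻¹' S ∩
        restrictTo (touches ends (cluster ends (sepConfig ends {a₁, a₂}) o))ᶜ ⁻¹' T := by
    ext ω
    simp only [Set.mem_inter_iff, Set.mem_preimage]
    constructor
    · rintro ⟨hs, ht⟩
      have hω := not_conn_of_mem_of_subset hSQ hs
      exact ⟨(hS ω hω).1 hs, (hT ω hω).1 ht⟩
    · rintro ⟨hs, ht⟩
      have hω : ¬ Conn ends ω a₁ a₂ :=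
        (hDω ω).2 ⟨not_conn_of_mem_of_subset hSQ hs, not_conn_of_mem_of_subset hTQ ht⟩
      exact ⟨(hS ω hω).2 hs, (hT ω hω).2 ht⟩
  have e2 : avoidAll ends a₂ {a₁} =
      restrictTo (touches ends (cluster ends (sepConfig ends {a₁, a₂}) o)) ⁻¹'
          avoidAll ends a₂ {a₁} ∩
        restrictTo (touches ends (cluster ends (sepConfig ends {a₁, a₂}) o))ᶜ ⁻¹'
          avoidAll ends a₂ {a₁} := by
    ext ω
    simp only [Set.mem_inter_iff, Set.mem_preimage, mem_Q]
    exact hDω ω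
  have e3 : S =
      restrictTo (touches ends (cluster ends (sepConfig ends {a₁, a₂}) o)) ⁻¹' S ∩
        restrictTo (touches ends (cluster ends (sepConfig ends {a₁, a₂}) o))ᶜ ⁻¹'
          avoidAll ends a₂ {a₁} := by
    ext ω
    simp only [Set.mem_inter_iff, Set.mem_preimage, mem_Q]
    constructor
    · intro hs
      have hω := not_conn_of_mem_of_subset hSQ hs
      exact ⟨(hS ω hω).1 hs, ((hDω ω).1 hω).2⟩
    · rintro ⟨hs, h₂⟩
      have hω : ¬ Conn ends ω a₁ a₂ := (hDω ω).2 ⟨not_conn_of_mem_of_subset hSQ hs, h₂⟩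
      exact (hS ω hω).2 hs
  have e4 : T =
      restrictTo (touches ends (cluster ends (sepConfig ends {a₁, a₂}) o)) ⁻¹'
          avoidAll ends a₂ {a₁} ∩
        restrictTo (touches ends (cluster ends (sepConfig ends {a₁, a₂}) o))ᶜ ⁻¹' T := by
    ext ω
    simp only [Set.mem_inter_iff, Set.mem_preimage, mem_Q]
    constructor
    · intro ht
      have hω := not_conn_of_mem_of_subset hTQ ht
      exact ⟨((hDω ω).1 hω).1, (hT ω hω).1 ht⟩
    · rintro ⟨h₁, ht⟩
      have hω : ¬ Conn ends ω a₁ a₂ := (hDω ω).2 ⟨h₁, not_conn_of_mem_of_subset hTQ ht⟩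
      exact (hT ω hω).2 ht
  have p1 := congrArg (prob p) e1
  have p2 := congrArg (prob p) e2
  have p3 := congrArg (prob p) e3
  have p4 := congrArg (prob p) e4
  rw [ind] at p1 p2 p3 p4
  rw [p1, p2, p3, p4]
  ring

omit [Fintype E] [DecidableEq E] in
/-- `W ∩ (X ∩ Y) = (Q ∩ X) ∩ (W ∩ Y)` for `W ⊆ Q`. -/
lemma inter_inter_eq {W X Y : Set (Config E)} (hWQ : W ⊆ avoidAll ends a₂ {a₁}) :
    W ∩ (X ∩ Y) = (avoidAll ends a₂ {a₁} ∩ X) ∩ (W ∩ Y) := by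
  ext ω
  simp only [Set.mem_inter_iff]
  exact ⟨fun ⟨hw, hx, hy⟩ => ⟨⟨hWQ hw, hx⟩, hw, hy⟩, fun ⟨⟨_, hx⟩, hw, hy⟩ => ⟨hw, hx, hy⟩⟩

/-- **Mass factorisation, `a₃` on the `b`-side**: for `W ⊆ Q` determined by `F₂`, `X` by `F₁`
and `Y` by `F₂`: `P(W ∩ (X ∩ Y)) · P(Q) = P(Q ∩ X) · P(W ∩ Y)`. -/
theorem mass_split (p : E → R) (ho : o ∉ ({a₁, a₂} : Set V)) {W X Y : Set (Config E)}
    (hWQ : W ⊆ avoidAll ends a₂ {a₁})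
    (hW : DetOn ends a₁ a₂ (touches ends (cluster ends (sepConfig ends {a₁, a₂}) o))ᶜ W)
    (hX : DetOn ends a₁ a₂ (touches ends (cluster ends (sepConfig ends {a₁, a₂}) o)) X)
    (hY : DetOn ends a₁ a₂ (touches ends (cluster ends (sepConfig ends {a₁, a₂}) o))ᶜ Y) :
    prob p (W ∩ (X ∩ Y)) * prob p (avoidAll ends a₂ {a₁}) =
      prob p (avoidAll ends a₂ {a₁} ∩ X) * prob p (W ∩ Y) := by
  rw [inter_inter_eq hWQ]
  exact prob_inter_mul_of_detOn p ho Set.inter_subset_left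
    (Set.inter_subset_left.trans hWQ) (detOn_Q.inter hX) (hW.inter hY)

/-- `mass_split` without a `b`-factor: `P(W ∩ X) · P(Q) = P(Q ∩ X) · P(W)`. -/
theorem mass_split_one (p : E → R) (ho : o ∉ ({a₁, a₂} : Set V)) {W X : Set (Config E)}
    (hWQ : W ⊆ avoidAll ends a₂ {a₁})
    (hW : DetOn ends a₁ a₂ (touches ends (cluster ends (sepConfig ends {a₁, a₂}) o))ᶜ W)
    (hX : DetOn ends a₁ a₂ (touches ends (cluster ends (sepConfig ends {a₁, a₂}) o)) X) :
    prob p (W ∩ X) * prob p (avoidAll ends a₂ {a₁}) =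
      prob p (avoidAll ends a₂ {a₁} ∩ X) * prob p W := by
  have h := mass_split p ho hWQ hW hX (Y := Set.univ) detOn_univ
  simpa only [Set.inter_univ] using h

omit [Fintype E] [DecidableEq E] in
/-- `W ∩ (X ∩ Y) = (W ∩ X) ∩ (Q ∩ Y)` for `W ⊆ Q`. -/
lemma inter_inter_eq' {W X Y : Set (Config E)} (hWQ : W ⊆ avoidAll ends a₂ {a₁}) :
    W ∩ (X ∩ Y) = (W ∩ X) ∩ (avoidAll ends a₂ {a₁} ∩ Y) := by
  ext ω
  simp only [Set.mem_inter_iff]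
  exact ⟨fun ⟨hw, hx, hy⟩ => ⟨⟨hw, hx⟩, hWQ hw, hy⟩, fun ⟨⟨hw, hx⟩, _, hy⟩ => ⟨hw, hx, hy⟩⟩

/-- **Mass factorisation, `a₃` on the `o`-side**: for `W ⊆ Q` determined by `F₁`, `X` by `F₁`
and `Y` by `F₂`: `P(W ∩ (X ∩ Y)) · P(Q) = P(W ∩ X) · P(Q ∩ Y)`. -/
theorem mass_split' (p : E → R) (ho : o ∉ ({a₁, a₂} : Set V)) {W X Y : Set (Config E)}
    (hWQ : W ⊆ avoidAll ends a₂ {a₁})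
    (hW : DetOn ends a₁ a₂ (touches ends (cluster ends (sepConfig ends {a₁, a₂}) o)) W)
    (hX : DetOn ends a₁ a₂ (touches ends (cluster ends (sepConfig ends {a₁, a₂}) o)) X)
    (hY : DetOn ends a₁ a₂ (touches ends (cluster ends (sepConfig ends {a₁, a₂}) o))ᶜ Y) :
    prob p (W ∩ (X ∩ Y)) * prob p (avoidAll ends a₂ {a₁}) =
      prob p (W ∩ X) * prob p (avoidAll ends a₂ {a₁} ∩ Y) := by
  rw [inter_inter_eq' hWQ]
  exact prob_inter_mul_of_detOn p ho (Set.inter_subset_left.trans hWQ)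
    Set.inter_subset_left (hW.inter hX) (detOn_Q.inter hY)

/-- `mass_split'` without an `o`-factor: `P(W ∩ Y) · P(Q) = P(W) · P(Q ∩ Y)`. -/
theorem mass_split_one' (p : E → R) (ho : o ∉ ({a₁, a₂} : Set V)) {W Y : Set (Config E)}
    (hWQ : W ⊆ avoidAll ends a₂ {a₁})
    (hW : DetOn ends a₁ a₂ (touches ends (cluster ends (sepConfig ends {a₁, a₂}) o)) W)
    (hY : DetOn ends a₁ a₂ (touches ends (cluster ends (sepConfig ends {a₁, a₂}) o))ᶜ Y) :
    prob p (W ∩ Y) * prob p (avoidAll ends a₂ {a₁}) =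
      prob p W * prob p (avoidAll ends a₂ {a₁} ∩ Y) := by
  have h := mass_split' p ho hWQ hW (X := Set.univ) detOn_univ hY
  simpa only [Set.inter_univ, Set.univ_inter] using h

end Product

/-! ## The sub-events of `Q` -/

section SubQ

variable {V : Type*} {E : Type*} {ends : E → Sym2 V} {a₁ a₂ a₃ : V}

/-- `T ⊆ Q`. -/
lemma T_subset_Q : TEvent ends a₁ a₂ a₃ ⊆ avoidAll ends a₂ {a₁} :=
  fun _ h => mem_Q.2 (mem_T.1 h).1

/-- `T′ ⊆ Q`. -/
lemma T'_subset_Q : TEvent ends a₂ a₁ a₃ ⊆ avoidAll ends a₂ {a₁} :=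
  fun _ h => mem_Q.2 (mem_T'.1 h).1

/-- `PD ⊆ Q`. -/
lemma PD_subset_Q : PDEvent ends a₁ a₂ a₃ ⊆ avoidAll ends a₂ {a₁} :=
  fun _ h => mem_Q.2 (mem_PD.1 h).1

end SubQ

end SepTwoGcZero

end Summit.Ventures.PercRepro2
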